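import Summits.HodgeConjecture.CorCM.GaloisRealFactorComplementTypes
import Summits.HodgeConjecture.CorCM.AdmissibleHalvesIndexTwo
import Summits.HodgeConjecture.CorCM.GaloisTwentyFourDegenerateModels
import Summits.HodgeConjecture.CorCM.InvolutionsOutsideSubgroups
import HarnessLib

/-!
# A totally real factor is fatal — internal form: `Gal(K/L) ∉ {1, C₂, C₂², C₂³, C₄, C_p, S₃}` for a Galois CM
# subfield `L` with a primitive type and a totally real complement (`M` need not be Galois)

COR-CM (cell `pub-hodgecm2`), binder seat b04 (gen 24), count-neutral claim REAL-FACTOR, part V (blanket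
`CorCM/GaloisRealFactor*`, HOME/INBOX l.10153).  HC_CM is NOT proved here; unconditional negative-side theorems.
KERNEL ONLY: theorems; no definition, no named fact, no `sorry`.

SETTING (subgroup form).  `K/ℚ` a Galois CM field, `G = Gal(K/ℚ)`, `c` complex conjugation (central).  `N ⊴ G` a
NORMAL subgroup and `Γ' ≤ G` with `N ∩ Γ' = 1`, `G = N Γ'`, `c ∈ Γ'`: field-theoretically `N = Gal(K/L)` for a Galois
CM subfield `L` and `Γ' = Gal(K/M)` for a TOTALLY REAL subfield `M ⊆ K⁺` with `K = M · L` and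
`[K:ℚ] = [M:ℚ][L:ℚ]`; `Γ' ≅ Gal(L/ℚ)` by restriction, and `F ⊆ Γ'` is a PRIMITIVE CM type of `L`.  Parts II–III
(`CorCM/GaloisTransversalCompositum`, `CorCM/GaloisRealFactorDegenerate`) treat `Γ' ⊴ G`, i.e. `M` Galois and
`G = N × Γ'`; here `G = N ⋊ Γ'` is a semidirect product — e.g. `Dic_n = C_n ⋊ C₄` (`n` odd; `L` cyclic quartic,
`M` a non-Galois totally real field of degree `n`), `C₃² ⋊ C₄`, `A₄ ⋊ C₄`, `C₃² ⋊ Q₈`.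

**Theorem (`exists_simple_degenerate_of_complement`).**  Unless `N` has exponent `≤ 2` and order `≤ 8`, or order
`4`, or prime order, or order `6` and is non-abelian, `K` carries a SIMPLE DEGENERATE abelian variety of dimension
`[K:ℚ]/2` with CM by `K` (exceptional Hodge classes on a power).  Proof as in part III, with part IV's internal
certificates: a subgroup `V ≤ N`, `3 ≤ |V|`, with a non-involution of `N` outside gives the TRANSVERSAL certificate;
otherwise gen 19 part VIII (`TwiceOdd.dihedral_or_of_forall_mul_self_eq_one`, stated for subgroups) leaves exponent
`2` of order `≥ 16` and `D_p`, `p ≥ 5`, which have ADMISSIBLE HALVES (part I) for the TWO-FIBRE certificate; both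
certificates are read on `Gal(K/ℚ)` by gen 20's `GaloisModels.exists_simple_degenerate_of_model_balanced` with the
identity model.  Consequence: gen 20's «`Dic_n` with `n` odd composite is BAD» is the case `N = C_n`, `Γ' = C₄`;
new: `C₃² ⋊ C₄`, `C₁₅ ⋊ C₄` (beyond `Dic₁₅`: any action through `C₂`), `A₄ ⋊ C₄`, `C₃² ⋊ Q₈`, … (`scratch/g24c.py`).

References: Shimura (1998), §6.2 Thm. 3, §8.2 Prop. 26 [cite: Shimura1998]; Gordon (1999), Thm. 6.4, §9.3
[cite: Gordon1999HodgeAVSurvey]; Dodson (1984), §3.1.1, §4.1 [cite: Dodson1984].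
-/

noncomputable section

open CategoryTheory CategoryTheory.Limits NumberField
open scoped BigOperators

namespace Summit.HodgeConjecture.CorCM.Complement

open Literature.NumberTheory.ComplexMultiplication
open Literature.AlgebraicGeometry.Motives (AbelianVariety CMType)
open Literature.AlgebraicGeometry.HodgeTheory
open Literature.AlgebraicGeometry.ComplexMultiplication (IsCMTypeRealisation)
open Literature.AlgebraicGeometry.Pohlmann1968
open Literature.Barriers.HodgeConjecture (divisorClassesSpan)
open Summit.HodgeConjecture.CorCM.GaloisOctic (complexConj_mul_comm complexConj_mul_self)
open Summit.HodgeConjecture.CorCM.GaloisModels (exists_simple_degenerate_of_model_balanced)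
open Summit.HodgeConjecture.CorCM.TwiceOdd (dihedral_or_of_forall_mul_self_eq_one)
open Summit.HodgeConjecture.CorCM.AdmissibleHalves (exists_half_of_exponent_two exists_half_of_orderOf)

variable {K : Type} [Field K] [NumberField K] [IsCMField K] [IsGalois ℚ K]

/-! ## §1 Certificates on `Gal(K/ℚ)` itself -/

/-- **Certificate on `Gal(K/ℚ)` ⟹ simple degenerate CM abelian variety** (gen 20's model certificate with the
identity model): a CM set `T` with trivial left stabiliser and a balanced finite set `D` moved by `c`.
[cite: Shimura1998, §6.2 Thm. 3 and §8.2 Prop. 26] [cite: Gordon1999HodgeAVSurvey, Thm. 6.4 and §9.3] -/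
theorem exists_simple_degenerate_of_certificate [DecidableEq (K ≃ₐ[ℚ] K)] (T D : Finset (K ≃ₐ[ℚ] K))
    (hcm : ∀ x, x ∈ T ↔ (IsCMField.complexConj K).restrictScalars ℚ * x ∉ T)
    (hprim : ∀ y : K ≃ₐ[ℚ] K, y ≠ 1 → ∃ w, ¬ (w ∈ T ↔ y * w ∈ T))
    (hbal : ∀ g, 2 * (D.filter fun x => x * g ∈ T).card = D.card)
    (hmov : ∃ x ∈ D, (IsCMField.complexConj K).restrictScalars ℚ * x ∉ D) :
    ∃ (Φ : CMType K) (φ₀ : K →+* ℂ) (A : AbelianVariety ℂ) (ι : 𝓞 K →+* End A)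
      (θ : K →+* Module.End ℂ (complexBetti A.X 1)),
      IsPrimitive (ℂ ≃+* ℂ) Φ.1 φ₀ ∧ ¬ IsNondegenerate Φ ∧ IsCMTypeRealisation Φ A ι θ ∧ A.IsSimple ∧
      A.dim = Module.finrank ℚ K / 2 ∧
      ∃ n p : ℕ, ∃ x : complexBetti (⨁ fun _ : Fin n => A).X (2 * p), IsRationalClass x ∧
        IsOfHodgeType (⨁ fun _ : Fin n => A).dim (⨁ fun _ : Fin n => A).X (2 * p) p p x ∧
        x ∉ divisorClassesSpan (⨁ fun _ : Fin n => A).X (⨁ fun _ : Fin n => A).dim p := by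
  have h := exists_simple_degenerate_of_model_balanced (MulEquiv.refl (K ≃ₐ[ℚ] K)) _ rfl T hcm hprim D hbal hmov
  rwa [← Nat.card_eq_fintype_card, IsGalois.card_aut_eq_finrank] at h

/-- An admissible half of the group `↥N` (part I) as a finset of `G` inside `N`. [folklore] -/
theorem exists_half_coe {G : Type*} [Group G] {N : Subgroup G} [Fintype N] (A : Finset N)
    (hAcard : 2 * A.card = Fintype.card N) (hAprim : ∀ a : N, a ≠ 1 → ∃ q, ¬ (q ∈ A ↔ a * q ∈ A))
    (hAcomp : ∀ a : N, ∃ q, (q ∈ A ↔ a * q ∈ A)) :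
    ∃ A' : Finset G, (∀ q ∈ A', q ∈ N) ∧ 2 * A'.card = Nat.card N ∧
      (∀ a ∈ N, a ≠ 1 → ∃ q ∈ N, ¬ (q ∈ A' ↔ a * q ∈ A')) ∧ (∀ a ∈ N, ∃ q ∈ N, (q ∈ A' ↔ a * q ∈ A')) := by
  classical
  set emb : N ↪ G := ⟨Subtype.val, Subtype.val_injective⟩ with hemb
  have hmem : ∀ x : N, (x : G) ∈ A.map emb ↔ x ∈ A := fun x => Finset.mem_map' emb
  refine ⟨A.map emb, fun q hq => ?_, ?_, fun a ha ha1 => ?_, fun a ha => ?_⟩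
  · obtain ⟨y, -, rfl⟩ := Finset.mem_map.1 hq; exact y.2
  · rw [Finset.card_map, hAcard, Nat.card_eq_fintype_card]
  · obtain ⟨q, hq⟩ := hAprim ⟨a, ha⟩ (fun h => ha1 (Subtype.ext_iff.1 h))
    exact ⟨q.1, q.2, fun h => hq ((hmem q).symm.trans (h.trans (hmem (⟨a, ha⟩ * q))))⟩
  · obtain ⟨q, hq⟩ := hAcomp ⟨a, ha⟩
    exact ⟨q.1, q.2, (hmem q).trans (hq.trans (hmem (⟨a, ha⟩ * q)).symm)⟩

/-! ## §2 The theorem -/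

/-- **A TOTALLY REAL FACTOR IS FATAL (internal form).**  `K/ℚ` Galois CM, `N ⊴ Gal(K/ℚ)` normal with a complement
`Γ' ∋ c` (`N ∩ Γ' = 1`, `G = NΓ'`), `F ⊆ Γ'` a primitive CM set of `(Γ', c)`.  If `N` is not of exponent `≤ 2` with
`|N| ≤ 8`, `|N| ≠ 4`, `|N|` is not prime and `N` is abelian when `|N| = 6` — `N ∉ {1, C₂, C₂², C₂³, C₄, C_p, S₃}` —
then `K` carries a SIMPLE DEGENERATE abelian variety of dimension `[K:ℚ]/2` with CM by `K`, with a rational `(p,p)`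
class outside the divisor ring on some power. [cite: Shimura1998, §6.2 Thm. 3 and §8.2 Prop. 26]
[cite: Gordon1999HodgeAVSurvey, Thm. 6.4 and §9.3] [cite: Dodson1984, §3.1.1 and §4.1] -/
theorem exists_simple_degenerate_of_complement (N Γ' : Subgroup (K ≃ₐ[ℚ] K)) [N.Normal]
    (hdisj : ∀ g, g ∈ N → g ∈ Γ' → g = 1) (hprod : ∀ g : K ≃ₐ[ℚ] K, ∃ q ∈ N, ∃ γ ∈ Γ', g = q * γ)
    (hcΓ : (IsCMField.complexConj K).restrictScalars ℚ ∈ Γ') (F : Finset (K ≃ₐ[ℚ] K))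
    (hFcm : ∀ v ∈ Γ', v ∈ F ↔ (IsCMField.complexConj K).restrictScalars ℚ * v ∉ F)
    (hFprim : ∀ b ∈ Γ', b ≠ 1 → ∃ v ∈ Γ', ¬ (v ∈ F ↔ b * v ∈ F))
    (hexp : (∀ h ∈ N, h * h = 1) → 8 < Nat.card N) (h4 : Nat.card N ≠ 4) (hprime : ¬ (Nat.card N).Prime)
    (h6 : Nat.card N = 6 → ∀ a ∈ N, ∀ b ∈ N, a * b = b * a) :
    ∃ (Φ : CMType K) (φ₀ : K →+* ℂ) (A : AbelianVariety ℂ) (ι : 𝓞 K →+* End A)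
      (θ : K →+* Module.End ℂ (complexBetti A.X 1)),
      IsPrimitive (ℂ ≃+* ℂ) Φ.1 φ₀ ∧ ¬ IsNondegenerate Φ ∧ IsCMTypeRealisation Φ A ι θ ∧ A.IsSimple ∧
      A.dim = Module.finrank ℚ K / 2 ∧
      ∃ n p : ℕ, ∃ x : complexBetti (⨁ fun _ : Fin n => A).X (2 * p), IsRationalClass x ∧
        IsOfHodgeType (⨁ fun _ : Fin n => A).dim (⨁ fun _ : Fin n => A).X (2 * p) p p x ∧
        x ∉ divisorClassesSpan (⨁ fun _ : Fin n => A).X (⨁ fun _ : Fin n => A).dim p := by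
  classical
  set c : K ≃ₐ[ℚ] K := (IsCMField.complexConj K).restrictScalars ℚ with hc_def
  have hcz : ∀ g : K ≃ₐ[ℚ] K, c * g = g * c := fun g => complexConj_mul_comm g
  have hcc : c * c = 1 := complexConj_mul_self
  have hc1 : c ≠ 1 := GaloisRank.model_complexConj_ne_one (MulEquiv.refl _) rfl
  -- two-fibre route from an admissible half of `↥N`
  have routeA : ∀ A : Finset N, 2 * A.card = Fintype.card N → (∀ a : N, a ≠ 1 → ∃ q, ¬ (q ∈ A ↔ a * q ∈ A)) →
      (∀ a : N, ∃ q, (q ∈ A ↔ a * q ∈ A)) →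
      ∃ (Φ : CMType K) (φ₀ : K →+* ℂ) (A : AbelianVariety ℂ) (ι : 𝓞 K →+* End A)
        (θ : K →+* Module.End ℂ (complexBetti A.X 1)),
        IsPrimitive (ℂ ≃+* ℂ) Φ.1 φ₀ ∧ ¬ IsNondegenerate Φ ∧ IsCMTypeRealisation Φ A ι θ ∧ A.IsSimple ∧
        A.dim = Module.finrank ℚ K / 2 ∧
        ∃ n p : ℕ, ∃ x : complexBetti (⨁ fun _ : Fin n => A).X (2 * p), IsRationalClass x ∧
          IsOfHodgeType (⨁ fun _ : Fin n => A).dim (⨁ fun _ : Fin n => A).X (2 * p) p p x ∧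
          x ∉ divisorClassesSpan (⨁ fun _ : Fin n => A).X (⨁ fun _ : Fin n => A).dim p := by
    intro A hAcard hAprim hAcomp
    obtain ⟨A', hA'N, hA'card, hA'prim, hA'comp⟩ := exists_half_coe A hAcard hAprim hAcomp
    obtain ⟨T, D, hcm, hstab, hbal, hmov⟩ := exists_certificate_twoFibre hdisj hprod hcΓ hcz hc1 hcc hFcm hFprim
      A' hA'N hA'card hA'prim hA'comp
    exact exists_simple_degenerate_of_certificate T D hcm hstab hbal hmov
  by_cases hV : ∃ V : Subgroup (K ≃ₐ[ℚ] K), V ≤ N ∧ 3 ≤ Nat.card V ∧ ∃ y ∈ N, y ∉ V ∧ y * y ≠ 1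
  · -- transversal route
    obtain ⟨V, hVN, h3, y₀, hy₀N, hy₀V, hy₀2⟩ := hV
    obtain ⟨T, D, hcm, hstab, hbal, hmov⟩ := exists_certificate_transversal hdisj hprod hcΓ hcz hc1 hcc hFcm hFprim
      V hVN h3 hy₀N hy₀V hy₀2
    exact exists_simple_degenerate_of_certificate T D hcm hstab hbal hmov
  have hyp : ∀ V : Subgroup (K ≃ₐ[ℚ] K), V ≤ N → 3 ≤ Nat.card V → V ≠ N → ∀ y ∈ N, y ∉ V → y * y = 1 := by
    intro V hVN h3 _ y hy hyV
    by_contra hyy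
    exact hV ⟨V, hVN, h3, y, hy, hyV, hyy⟩
  have hNcard : Fintype.card N = Nat.card N := by rw [Nat.card_eq_fintype_card]
  rcases dihedral_or_of_forall_mul_self_eq_one hyp with hA | hB | hC |
      ⟨r, hr, s, hs, p, hp, hp3, hord, -, -, hsrs, h2p⟩
  · -- (A) exponent `2`: `|N| = 2^j > 8`, so `≥ 16`: admissible half of `↥N`
    have hexp' : ∀ h : N, h * h = 1 := fun h => Subtype.ext (hA h.1 h.2)
    have h16 : 16 ≤ Fintype.card N := by
      haveI : Fact (Nat.Prime 2) := ⟨Nat.prime_two⟩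
      have hPG : IsPGroup 2 N := fun g => ⟨1, by rw [pow_one, pow_two, hexp']⟩
      obtain ⟨j, hj⟩ := IsPGroup.iff_card.1 hPG
      have h8 := hexp hA
      rw [hj] at h8
      rw [hNcard, hj]
      have hj4 : 4 ≤ j := by
        by_contra hlt
        have : 2 ^ j ≤ 2 ^ 3 := Nat.pow_le_pow_right (by norm_num) (by omega)
        omega
      exact le_trans (by norm_num) (Nat.pow_le_pow_right (by norm_num) hj4 : 2 ^ 4 ≤ 2 ^ j)
    obtain ⟨A, hAcard, hAprim, hAcomp⟩ := exists_half_of_exponent_two hexp' h16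
    exact routeA A hAcard hAprim hAcomp
  · exact absurd hB h4
  · exact absurd hC hprime
  · -- (D) `N` dihedral of order `2p`
    by_cases hp5 : 5 ≤ p
    · have hord' : orderOf (⟨r, hr⟩ : N) = p := by rw [← Subgroup.orderOf_coe]; exact hord
      obtain ⟨A, hAcard, hAprim, hAcomp⟩ := exists_half_of_orderOf hord' hp5 (by rw [hNcard, h2p])
      exact routeA A hAcard hAprim hAcomp
    · exfalso
      have hp3' : p = 3 := by
        rcases (show p = 3 ∨ p = 4 by omega) with h | h
        · exact h
        · exact absurd (h ▸ hp) (by decide)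
      subst hp3'
      have hcomm := h6 (by omega) s hs r hr
      have hr' : r⁻¹ = r := by rw [← hsrs, hcomm, mul_inv_cancel_right]
      have hr2 : r ^ 2 = 1 := by
        rw [pow_two]
        nth_rewrite 1 [← hr']
        exact inv_mul_cancel r
      have h32 : 3 ∣ 2 := by rw [← hord]; exact orderOf_dvd_of_pow_eq_one hr2
      omega

/-! ## §3 Field form: `K = L · M`, `L` Galois CM with a primitive type, `M ⊆ K⁺` totally real -/

/-- **FIELD FORM.**  `K/ℚ` Galois CM; `L ⊆ K` a subfield normal over `ℚ` (stable under `Gal(K/ℚ)`) and `M ⊆ K` a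
subfield fixed by complex conjugation (`M ⊆ K⁺`, totally real) with `Gal(K/L) ∩ Gal(K/M) = 1` (`K = L·M`) and
`[K:ℚ] = [K:L][K:M]` (linear disjointness); `F ⊆ Gal(K/M) ≅ Gal(L/ℚ)` a primitive CM type of `L`.  If
`[K:L] = [M:ℚ]` is not prime, `≠ 4`, and `Gal(K/L)` is neither of exponent `2` with `[K:L] ≤ 8` nor non-abelian of
order `6`, then `K` carries a SIMPLE DEGENERATE abelian variety of dimension `[K:ℚ]/2` with CM by `K` — `M` need not
be Galois. [cite: Shimura1998, §6.2 Thm. 3 and §8.2 Prop. 26] [cite: Gordon1999HodgeAVSurvey, Thm. 6.4]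
[cite: Dodson1984, §3.1.1] -/
theorem exists_simple_degenerate_of_totallyReal_complement (L M : IntermediateField ℚ K)
    (hL : ∀ σ : K ≃ₐ[ℚ] K, ∀ x : K, x ∈ L → σ x ∈ L)
    (hdisj : ∀ g : K ≃ₐ[ℚ] K, g ∈ L.fixingSubgroup → g ∈ M.fixingSubgroup → g = 1)
    (hdeg : Module.finrank ℚ K = Module.finrank L K * Module.finrank M K)
    (hcM : (IsCMField.complexConj K).restrictScalars ℚ ∈ M.fixingSubgroup) (F : Finset (K ≃ₐ[ℚ] K))
    (hFcm : ∀ v ∈ M.fixingSubgroup, v ∈ F ↔ (IsCMField.complexConj K).restrictScalars ℚ * v ∉ F)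
    (hFprim : ∀ b ∈ M.fixingSubgroup, b ≠ 1 → ∃ v ∈ M.fixingSubgroup, ¬ (v ∈ F ↔ b * v ∈ F))
    (hexp : (∀ h ∈ L.fixingSubgroup, h * h = 1) → 8 < Module.finrank L K) (h4 : Module.finrank L K ≠ 4)
    (hprime : ¬ (Module.finrank L K).Prime)
    (h6 : Module.finrank L K = 6 → ∀ a ∈ L.fixingSubgroup, ∀ b ∈ L.fixingSubgroup, a * b = b * a) :
    ∃ (Φ : CMType K) (φ₀ : K →+* ℂ) (A : AbelianVariety ℂ) (ι : 𝓞 K →+* End A)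
      (θ : K →+* Module.End ℂ (complexBetti A.X 1)),
      IsPrimitive (ℂ ≃+* ℂ) Φ.1 φ₀ ∧ ¬ IsNondegenerate Φ ∧ IsCMTypeRealisation Φ A ι θ ∧ A.IsSimple ∧
      A.dim = Module.finrank ℚ K / 2 ∧
      ∃ n p : ℕ, ∃ x : complexBetti (⨁ fun _ : Fin n => A).X (2 * p), IsRationalClass x ∧
        IsOfHodgeType (⨁ fun _ : Fin n => A).dim (⨁ fun _ : Fin n => A).X (2 * p) p p x ∧
        x ∉ divisorClassesSpan (⨁ fun _ : Fin n => A).X (⨁ fun _ : Fin n => A).dim p := by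
  classical
  set N : Subgroup (K ≃ₐ[ℚ] K) := L.fixingSubgroup with hN_def
  set Γ' : Subgroup (K ≃ₐ[ℚ] K) := M.fixingSubgroup with hΓ_def
  haveI : N.Normal := by
    refine ⟨fun n hn g => ?_⟩
    rw [hN_def, IntermediateField.mem_fixingSubgroup_iff] at hn ⊢
    intro x hx
    rw [AlgEquiv.mul_apply, AlgEquiv.mul_apply, hn (g⁻¹ x) (hL g⁻¹ x hx)]
    change g (g.symm x) = x
    exact g.apply_symm_apply x
  have hNcard : Nat.card N = Module.finrank L K := IsGalois.card_fixingSubgroup_eq_finrank L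
  have hΓcard : Nat.card Γ' = Module.finrank M K := IsGalois.card_fixingSubgroup_eq_finrank M
  -- `(q, γ) ↦ q γ` is a bijection `N × Γ' → G`
  have hbij : Function.Bijective fun x : N × Γ' => (x.1 : K ≃ₐ[ℚ] K) * x.2 := by
    rw [Nat.bijective_iff_injective_and_card]
    refine ⟨fun x y hxy => ?_, ?_⟩
    · obtain ⟨h1, h2⟩ := eq_of_mul_eq_mul hdisj x.1.2 y.1.2 x.2.2 y.2.2 hxy
      exact Prod.ext (Subtype.ext h1) (Subtype.ext h2)
    · rw [Nat.card_prod, hNcard, hΓcard, ← hdeg, IsGalois.card_aut_eq_finrank]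
  have hprod : ∀ g : K ≃ₐ[ℚ] K, ∃ q ∈ N, ∃ γ ∈ Γ', g = q * γ := fun g => by
    obtain ⟨⟨q, γ⟩, h⟩ := hbij.2 g
    exact ⟨q, q.2, γ, γ.2, h.symm⟩
  rw [← hNcard] at hexp h4 hprime h6
  exact exists_simple_degenerate_of_complement N Γ' hdisj hprod hcM F hFcm hFprim hexp h4 hprime h6

end Summit.HodgeConjecture.CorCM.Complement

end
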